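import Mathlib.MeasureTheory.Integral.Lebesgue.Basic
import Mathlib.MeasureTheory.Constructions.BorelSpace.Real
import Mathlib.Analysis.SpecialFunctions.Log.Basic

/-!
# Stub `stub_tiltLever` of line `determinant-tilt`
(crux `Summit.QuantumFields.QCD.Theses.SpectralDefectExtinction.ExtinctionBuildsQCD`, item stmt-QuantumFields-18064)

THE DETERMINANT TILT, abstract form: two elementary measure-theoretic inequalities on `ℝ`, valid for EVERY
measure `ν` (read: the quenched conditional law of a well's level, tilted by the determinant factor `|λ|ⁿ`).

* (i) `tilt_lintegral_le`: for `n : ℕ`, any `τ` and `0 ≤ θ`,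
  `(∫_{|x|<τ} |x|ⁿ dν) · (θⁿ · ν{θ ≤ |x|}) ≤ (τⁿ · ν{|x|<τ}) · ∫_{θ≤|x|} |x|ⁿ dν` — bound `|x|ⁿ ≤ τⁿ` on the
  first set and `θⁿ ≤ |x|ⁿ` on the second, then multiply (proof copied from the planner's sketch
  `Sketch_determinant_tilt.lean:tilt_lintegral`).
* (ii) `logMoment_lintegral_le`: for `1 ≤ n`, `0 < θ`,
  `∫_{|x|<θ} |x|ⁿ log⁴(θ/|x|) dν ≤ (4/(n e))⁴ · θⁿ · ν{|x| < θ}` — from the pointwise bound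
  `aⁿ log⁴(θ/a) ≤ (4/(n e))⁴ θⁿ` for `0 ≤ a < θ` (`pow_mul_log_pow_four_le`): with `u = log(θ/a) ≥ 0`,
  `n u/4 ≤ exp(n u/4 - 1)` (`Real.add_one_le_exp`) gives `u ≤ (4/(n e)) exp(n u/4)`, whose fourth power is
  `u⁴ ≤ (4/(n e))⁴ (θ/a)ⁿ`; at `a = 0` the integrand vanishes since `n ≥ 1`.

Mathlib only; no named facts are used.
-/

noncomputable section

namespace Summit.QuantumFields.QCD.Cruxes.ExtinctionBuildsQCD.DeterminantTilt

open scoped ENNReal MeasureTheory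
open MeasureTheory Filter

/-! ## The pointwise bound behind the finite log-moment -/

/-- **Pointwise log-moment bound.** For `1 ≤ n`, `0 < θ` and `0 ≤ a < θ`:
`aⁿ · log⁴(θ/a) ≤ (4/(n e))⁴ · θⁿ` — the function `t ↦ tⁿ log⁴(1/t)` on `(0,1)` is maximal at
`t = e^{-4/n}` with value `(4/(n e))⁴`; at `a = 0` the left side is `0` (`0ⁿ = 0` as `n ≥ 1`). [folklore] -/
theorem pow_mul_log_pow_four_le {n : ℕ} (hn : 1 ≤ n) {θ a : ℝ} (hθ : 0 < θ) (ha0 : 0 ≤ a)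
    (ha : a < θ) : a ^ n * Real.log (θ / a) ^ 4 ≤ (4 / (n * Real.exp 1)) ^ 4 * θ ^ n := by
  rcases ha0.eq_or_lt with rfl | ha0
  · rw [zero_pow (Nat.one_le_iff_ne_zero.mp hn), zero_mul]
    positivity
  · have hya : 0 < θ / a := div_pos hθ ha0
    have hu0 : 0 ≤ Real.log (θ / a) := Real.log_nonneg ((one_le_div ha0).mpr ha.le)
    have hn0 : (0 : ℝ) < n := by exact_mod_cast hn
    have he : 0 < Real.exp 1 := Real.exp_pos 1
    -- `n u / 4 ≤ exp (n u / 4 - 1) = exp (n u / 4) / e`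
    have h1 : (n : ℝ) * Real.log (θ / a) / 4 * Real.exp 1 ≤ Real.exp ((n : ℝ) * Real.log (θ / a) / 4) := by
      have h := Real.add_one_le_exp ((n : ℝ) * Real.log (θ / a) / 4 - 1)
      rw [Real.exp_sub, le_div_iff₀ he] at h
      linarith
    -- hence `u ≤ (4 / (n e)) exp (n u / 4)`
    have h2 : Real.log (θ / a) ≤ 4 / (n * Real.exp 1) * Real.exp ((n : ℝ) * Real.log (θ / a) / 4) := by
      rw [div_mul_eq_mul_div, le_div_iff₀ (mul_pos hn0 he)]
      nlinarith
    -- fourth powers: `u⁴ ≤ (4/(n e))⁴ exp(n u) = (4/(n e))⁴ (θ/a)ⁿ`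
    have h3 : Real.log (θ / a) ^ 4 ≤
        (4 / (n * Real.exp 1)) ^ 4 * Real.exp ((n : ℝ) * Real.log (θ / a) / 4) ^ 4 := by
      rw [← mul_pow]
      exact pow_le_pow_left₀ hu0 h2 4
    have h4 : Real.exp ((n : ℝ) * Real.log (θ / a) / 4) ^ 4 = (θ / a) ^ n := by
      conv_rhs => rw [← Real.exp_log hya]
      rw [← Real.exp_nat_mul, ← Real.exp_nat_mul]
      congr 1
      push_cast
      ring
    calc a ^ n * Real.log (θ / a) ^ 4
        ≤ a ^ n * ((4 / (n * Real.exp 1)) ^ 4 * (θ / a) ^ n) := by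
          rw [← h4]
          exact mul_le_mul_of_nonneg_left h3 (pow_nonneg ha0.le n)
      _ = (4 / (n * Real.exp 1)) ^ 4 * θ ^ n := by
          rw [div_pow θ a n]
          field_simp

/-! ## The two integrated forms -/

/-- **The determinant tilt (i).** For any measure `ν` on `ℝ`, any `n : ℕ` and scales `τ`, `0 ≤ θ`:
`(∫_{|x|<τ} |x|ⁿ dν) · (θⁿ · ν{θ ≤ |x|}) ≤ (τⁿ · ν{|x| < τ}) · ∫_{θ≤|x|} |x|ⁿ dν`.  Read with the tilted law
`dν₊ ∝ |x|ⁿ dν`: `ν₊{|x| < τ} ≤ (τ/θ)ⁿ · ν{|x|<τ}/ν{θ ≤ |x|}` — no density bound on `ν` is used.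
(Proof copied from the planner's sketch `tilt_lintegral`.) [folklore] -/
theorem tilt_lintegral_le (ν : Measure ℝ) (n : ℕ) {τ θ : ℝ} (hθ : 0 ≤ θ) :
    (∫⁻ x in {x : ℝ | |x| < τ}, ENNReal.ofReal (|x| ^ n) ∂ν) * (ENNReal.ofReal (θ ^ n) * ν {x : ℝ | θ ≤ |x|}) ≤
      (ENNReal.ofReal (τ ^ n) * ν {x : ℝ | |x| < τ}) * ∫⁻ x in {x : ℝ | θ ≤ |x|}, ENNReal.ofReal (|x| ^ n) ∂ν := by
  -- adapted from Summits/QuantumFields/QCD/Cruxes/ExtinctionBuildsQCD/Sketch_determinant_tilt.lean:tilt_lintegral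
  have hS : MeasurableSet {x : ℝ | |x| < τ} :=
    measurableSet_lt continuous_abs.measurable measurable_const
  have hT : MeasurableSet {x : ℝ | θ ≤ |x|} :=
    measurableSet_le measurable_const continuous_abs.measurable
  have h1 : ∫⁻ x in {x : ℝ | |x| < τ}, ENNReal.ofReal (|x| ^ n) ∂ν ≤
      ENNReal.ofReal (τ ^ n) * ν {x : ℝ | |x| < τ} := by
    calc ∫⁻ x in {x : ℝ | |x| < τ}, ENNReal.ofReal (|x| ^ n) ∂ν
        ≤ ∫⁻ _ in {x : ℝ | |x| < τ}, ENNReal.ofReal (τ ^ n) ∂ν :=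
          setLIntegral_mono' hS fun x hx =>
            ENNReal.ofReal_le_ofReal (pow_le_pow_left₀ (abs_nonneg x) (le_of_lt hx) n)
      _ = ENNReal.ofReal (τ ^ n) * ν {x : ℝ | |x| < τ} := setLIntegral_const _ _
  have h2 : ENNReal.ofReal (θ ^ n) * ν {x : ℝ | θ ≤ |x|} ≤
      ∫⁻ x in {x : ℝ | θ ≤ |x|}, ENNReal.ofReal (|x| ^ n) ∂ν := by
    calc ENNReal.ofReal (θ ^ n) * ν {x : ℝ | θ ≤ |x|}
        = ∫⁻ _ in {x : ℝ | θ ≤ |x|}, ENNReal.ofReal (θ ^ n) ∂ν := (setLIntegral_const _ _).symm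
      _ ≤ ∫⁻ x in {x : ℝ | θ ≤ |x|}, ENNReal.ofReal (|x| ^ n) ∂ν :=
          setLIntegral_mono' hT fun x hx => ENNReal.ofReal_le_ofReal (pow_le_pow_left₀ hθ hx n)
  exact mul_le_mul' h1 h2

/-- **The finite log-moment (ii).** For any measure `ν` on `ℝ`, `1 ≤ n` and `0 < θ`:
`∫_{|x|<θ} |x|ⁿ log⁴(θ/|x|) dν ≤ (4/(n e))⁴ · θⁿ · ν{|x| < θ}` — integrate the pointwise bound
`pow_mul_log_pow_four_le` over the (measurable) set `{|x| < θ}`. [folklore] -/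
theorem logMoment_lintegral_le (ν : Measure ℝ) {n : ℕ} {θ : ℝ} (hn : 1 ≤ n) (hθ : 0 < θ) :
    ∫⁻ x in {x : ℝ | |x| < θ}, ENNReal.ofReal (|x| ^ n * Real.log (θ / |x|) ^ 4) ∂ν ≤
      ENNReal.ofReal ((4 / (n * Real.exp 1)) ^ 4 * θ ^ n) * ν {x : ℝ | |x| < θ} := by
  have hS : MeasurableSet {x : ℝ | |x| < θ} :=
    measurableSet_lt continuous_abs.measurable measurable_const
  calc ∫⁻ x in {x : ℝ | |x| < θ}, ENNReal.ofReal (|x| ^ n * Real.log (θ / |x|) ^ 4) ∂ν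
      ≤ ∫⁻ _ in {x : ℝ | |x| < θ}, ENNReal.ofReal ((4 / (n * Real.exp 1)) ^ 4 * θ ^ n) ∂ν :=
        setLIntegral_mono' hS fun x hx =>
          ENNReal.ofReal_le_ofReal (pow_mul_log_pow_four_le hn hθ (abs_nonneg x) hx)
    _ = ENNReal.ofReal ((4 / (n * Real.exp 1)) ^ 4 * θ ^ n) * ν {x : ℝ | |x| < θ} :=
        setLIntegral_const _ _

/-! ## The registered stub -/

/-- **Stub L (`stub_tiltLever`) — THE DETERMINANT TILT, abstract form.** (i) For ANY measure `ν` on `ℝ`, any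
`n : ℕ` and scales `τ`, `0 ≤ θ`: `(∫_{|x|<τ} |x|ⁿ dν)·(θⁿ·ν{θ ≤ |x|}) ≤ (τⁿ·ν{|x|<τ})·∫_{θ≤|x|} |x|ⁿ dν` — read with the tilted law
`dν₊ ∝ |x|ⁿdν` (the `⟨·⟩₊`-conditional law of a well's level, `|det D_W(m_f)| = ∏|λ(Γ₅D_W(m_f))|`): `ν₊{|x|<τ} ≤ (τ/θ)ⁿ·ν{|x|<τ}/ν{θ≤|x|}`,
non-resonance at EVERY scale from ONE quantile, no Wegner density (`tilt_lintegral_le`). (ii) The finite log-moment the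
two-well resonance sum consumes: for `n ≥ 1`, `θ > 0`, `∫_{|x|<θ} |x|ⁿ log⁴(θ/|x|) dν ≤ (4/(n e))⁴ · θⁿ · ν{|x| < θ}` (pointwise
`tⁿ log⁴(1/t) ≤ (4/(ne))⁴` on `(0,1)`, maximum at `t = e^{-4/n}`; the integrand vanishes at `x = 0`; `logMoment_lintegral_le`).
[folklore] -/
theorem stub_tiltLever :
    (∀ (ν : Measure ℝ) (n : ℕ) (τ θ : ℝ), 0 ≤ θ →
      (∫⁻ x in {x : ℝ | |x| < τ}, ENNReal.ofReal (|x| ^ n) ∂ν) * (ENNReal.ofReal (θ ^ n) * ν {x : ℝ | θ ≤ |x|}) ≤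
        (ENNReal.ofReal (τ ^ n) * ν {x : ℝ | |x| < τ}) * ∫⁻ x in {x : ℝ | θ ≤ |x|}, ENNReal.ofReal (|x| ^ n) ∂ν) ∧
    (∀ (ν : Measure ℝ) (n : ℕ) (θ : ℝ), 1 ≤ n → 0 < θ →
      ∫⁻ x in {x : ℝ | |x| < θ}, ENNReal.ofReal (|x| ^ n * Real.log (θ / |x|) ^ 4) ∂ν ≤
        ENNReal.ofReal ((4 / (n * Real.exp 1)) ^ 4 * θ ^ n) * ν {x : ℝ | |x| < θ}) :=
  ⟨fun ν n _ _ hθ => tilt_lintegral_le ν n hθ, fun ν _ _ hn hθ => logMoment_lintegral_le ν hn hθ⟩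

end Summit.QuantumFields.QCD.Cruxes.ExtinctionBuildsQCD.DeterminantTilt
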